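import Mathlib
import Summits.CriticalPhenomena.SAWScalingLimit.Theses.SAWDevelopingMap
import Summits.CriticalPhenomena.SAWScalingLimit.Theorems.SAWDevelopingMapSourceLoopBoundSourceLaw
import Summits.CriticalPhenomena.SAWScalingLimit.Theorems.NoFoldBound.Negative.SingletonTightness

/-!
# `NoFoldBound`, line Ideator3Sketch — glue lemmas for the boundary layer (core file)

Helper file for the crux `NoFoldBound` (stmt-CriticalPhenomena-8296) of the route
`SAWDevelopingMap`: elementary lemmas used by the lead's glue stub `stub_boundaryLayer_of`
(the no-fold inequality at the source vertex and at walled vertices from the leaf stubs).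

* `six_labellings` — the six labellings of three mid-edge values reduce to the six listed norms;
* `sum_weight_eq_of_winding_eq`, `sum_ite_weight_eq_of_winding_eq` — a sum of walk weights all
  of whose windings agree is the common phase times a nonnegative real sum;
* `betaT_div_alphaT_lt_one` — the contact-layer constant `β_T/α_T < 1`;
* `source_core` — at the SOURCE vertex the six labelled no-fold inequalities follow from the
  landed source law `SourceLoopBound.sourcePort`, the loop-winding stub (W1), the local turns
  (W6), the source algebra (B) and the loop bound of the item `SourceLoopBound` (hypotheses).
-/

noncomputable section

open scoped BigOperators
open Literature.Probability.LatticeModels Literature.Probability.RandomPlanarGeometry.SAW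

namespace Summit.CriticalPhenomena.SAWScalingLimit.Theorems.SAWDevelopingMapNoFoldBound

/-- **Six labellings.** If the six norms `‖G_a + ωG_b + ω²G_c‖` over the orderings `(a,b,c)` of
`(u,p,q)` are all `≤ k‖G_u + G_p + G_q‖`, then the no-fold inequality holds for every labelling
`w₀, w₁, w₂` of `{u, p, q}` by pairwise distinct names. [folklore] -/
theorem six_labellings (G : HexVertex → ℂ) (u p q : HexVertex) (k : ℝ)
    (h : let ω : ℂ := Complex.exp (2 * Real.pi * Complex.I / 3)
      let S : ℝ := ‖G u + G p + G q‖
      ‖G u + ω * G p + ω ^ 2 * G q‖ ≤ k * S ∧ ‖G u + ω * G q + ω ^ 2 * G p‖ ≤ k * S ∧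
      ‖G p + ω * G u + ω ^ 2 * G q‖ ≤ k * S ∧ ‖G p + ω * G q + ω ^ 2 * G u‖ ≤ k * S ∧
      ‖G q + ω * G u + ω ^ 2 * G p‖ ≤ k * S ∧ ‖G q + ω * G p + ω ^ 2 * G u‖ ≤ k * S)
    {w₀ w₁ w₂ : HexVertex} (h₀ : w₀ = u ∨ w₀ = p ∨ w₀ = q) (h₁ : w₁ = u ∨ w₁ = p ∨ w₁ = q)
    (h₂ : w₂ = u ∨ w₂ = p ∨ w₂ = q) (h₀₁ : w₀ ≠ w₁) (h₁₂ : w₁ ≠ w₂) (h₀₂ : w₀ ≠ w₂) :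
    ‖G w₀ + Complex.exp (2 * Real.pi * Complex.I / 3) * G w₁ +
        Complex.exp (2 * Real.pi * Complex.I / 3) ^ 2 * G w₂‖ ≤ k * ‖G w₀ + G w₁ + G w₂‖ := by
  dsimp only at h
  obtain ⟨c₁, c₂, c₃, c₄, c₅, c₆⟩ := h
  rcases h₀ with rfl | rfl | rfl <;> rcases h₁ with rfl | rfl | rfl <;>
    rcases h₂ with rfl | rfl | rfl <;>
    first
    | exact absurd rfl h₀₁
    | exact absurd rfl h₁₂
    | exact absurd rfl h₀₂
    | simpa only [add_comm, add_left_comm, add_assoc] using c₁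
    | simpa only [add_comm, add_left_comm, add_assoc] using c₂
    | simpa only [add_comm, add_left_comm, add_assoc] using c₃
    | simpa only [add_comm, add_left_comm, add_assoc] using c₄
    | simpa only [add_comm, add_left_comm, add_assoc] using c₅
    | simpa only [add_comm, add_left_comm, add_assoc] using c₆

/-- A sum of walk weights all of whose windings equal `W` is `e^{-iσW}` times the real sum
`Σ x^ℓ`. [folklore] -/
theorem sum_weight_eq_of_winding_eq {Λ : Finset HexVertex} {a z : Sym2 HexVertex} (W x σ : ℝ)
    (h : ∀ γ : HexMidEdgeSAW Λ a z, γ.winding = W) :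
    (∑ γ : HexMidEdgeSAW Λ a z, γ.weight x σ) =
      Complex.exp (-Complex.I * σ * W) *
        ((∑ γ : HexMidEdgeSAW Λ a z, x ^ γ.length : ℝ) : ℂ) := by
  rw [Complex.ofReal_sum, Finset.mul_sum]
  refine Finset.sum_congr rfl fun γ _ => ?_
  rw [HexMidEdgeSAW.weight, h γ]
  push_cast
  ring

/-- A restricted sum of walk weights all of whose windings equal `W` is `e^{-iσW}` times the
restricted real sum `Σ x^ℓ`. [folklore] -/
theorem sum_ite_weight_eq_of_winding_eq {Λ : Finset HexVertex} {a z : Sym2 HexVertex}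
    (P : HexMidEdgeSAW Λ a z → Prop) [DecidablePred P] (W x σ : ℝ)
    (h : ∀ γ : HexMidEdgeSAW Λ a z, P γ → γ.winding = W) :
    (∑ γ : HexMidEdgeSAW Λ a z, if P γ then γ.weight x σ else 0) =
      Complex.exp (-Complex.I * σ * W) *
        ((∑ γ : HexMidEdgeSAW Λ a z, if P γ then x ^ γ.length else 0 : ℝ) : ℂ) := by
  rw [Complex.ofReal_sum, Finset.mul_sum]
  refine Finset.sum_congr rfl fun γ _ => ?_
  by_cases hγ : P γ
  · rw [if_pos hγ, if_pos hγ, HexMidEdgeSAW.weight, h γ hγ]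
    push_cast
    ring
  · rw [if_neg hγ, if_neg hγ]
    push_cast
    ring

/-- The restricted real sum `Σ x^ℓ` is nonnegative for `x ≥ 0`. [folklore] -/
theorem sum_ite_pow_nonneg {Λ : Finset HexVertex} {a z : Sym2 HexVertex}
    (P : HexMidEdgeSAW Λ a z → Prop) [DecidablePred P] {x : ℝ} (hx : 0 ≤ x) :
    0 ≤ ∑ γ : HexMidEdgeSAW Λ a z, if P γ then x ^ γ.length else 0 :=
  Finset.sum_nonneg fun γ _ => by split_ifs <;> positivity

/-- **The contact-layer constant is `< 1`:** `β_T/α_T < 1`, i.e. `cos(11π/24) < cos(5π/24)`.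
[folklore] -/
theorem betaT_div_alphaT_lt_one :
    (1 + 2 * hexCriticalFugacity * Real.cos (11 * Real.pi / 24)) /
      (1 + 2 * hexCriticalFugacity * Real.cos (5 * Real.pi / 24)) < 1 := by
  rw [div_lt_one nfb_alphaT_pos]
  have hlt : Real.cos (11 * Real.pi / 24) < Real.cos (5 * Real.pi / 24) :=
    Real.cos_lt_cos_of_nonneg_of_le_pi_div_two (by linarith [Real.pi_pos])
      (by linarith [Real.pi_pos]) (by linarith [Real.pi_pos])
  have hx := nfb_xc_pos
  nlinarith

/-- The unique vertex of `Λ` on a boundary mid-edge: if `a = {u', v'} ∈ ∂Ω` with `v' ∈ Λ`,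
`u' ∉ Λ`, and `v ∈ Λ` lies on `a`, then `v = v'`. [folklore] -/
theorem eq_of_mem_boundary_pair {Λ : Finset HexVertex} {u' v' v : HexVertex} (hv' : v' ∈ Λ)
    (hu' : u' ∉ Λ) (hv : v ∈ Λ) (hva : v ∈ s(u', v')) : v = v' := by
  rcases Sym2.mem_iff.1 hva with rfl | rfl
  · exact absurd hv hu'
  · exact (fun _ => rfl) hv'

/-- The restricted first-arrival sum at the port `{v, w}`: if all first arrivals (walks to
`{v, w}` avoiding `v`) have winding `W`, the sum of their weights is `e^{-iσW}` times the real
sum `Σ x^ℓ`. [folklore] -/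
theorem sum_firstArrival_eq {Λ : Finset HexVertex} {a : Sym2 HexVertex} {v w : HexVertex}
    (W x σ : ℝ) (h : ∀ γ : HexMidEdgeSAW Λ a s(v, w), v ∉ γ.verts → γ.winding = W) :
    (∑ γ : HexMidEdgeSAW Λ a s(v, w), if v ∉ γ.verts then γ.weight x σ else 0) =
      Complex.exp (-Complex.I * σ * W) *
        ((∑ γ : HexMidEdgeSAW Λ a s(v, w), if v ∉ γ.verts then x ^ γ.length else 0 : ℝ) : ℂ) :=
  sum_ite_weight_eq_of_winding_eq (fun γ => v ∉ γ.verts) W x σ h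

/-- Combining two phase factors behind a real scalar and in front of a complex number.
[folklore] -/
theorem xexp_mul_exp_mul (x σ a b : ℝ) (w : ℂ) :
    (x : ℂ) * Complex.exp (-Complex.I * σ * (a : ℂ)) * (Complex.exp (-Complex.I * σ * (b : ℂ)) * w) =
      (x : ℂ) * Complex.exp (-Complex.I * σ * ((a + b : ℝ) : ℂ)) * w := by
  have h : Complex.exp (-Complex.I * σ * ((a + b : ℝ) : ℂ)) =
      Complex.exp (-Complex.I * σ * (a : ℂ)) * Complex.exp (-Complex.I * σ * (b : ℂ)) := by
    rw [← Complex.exp_add]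
    congr 1
    push_cast
    ring
  rw [h]
  ring

/-- Splitting a phase factor: `e^{-iσ(W - t)} = e^{-iσW} e^{iσt}`. [folklore] -/
theorem exp_sub_phase (σ W t : ℝ) :
    Complex.exp (-Complex.I * σ * ((W + -t : ℝ) : ℂ)) =
      Complex.exp (-Complex.I * σ * (W : ℂ)) * Complex.exp (Complex.I * σ * (t : ℂ)) := by
  rw [← Complex.exp_add]
  congr 1
  push_cast
  ring

end Summit.CriticalPhenomena.SAWScalingLimit.Theorems.SAWDevelopingMapNoFoldBound

namespace Summit.CriticalPhenomena.SAWScalingLimit.Theorems.SAWDevelopingMapNoFoldBound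

/-! ## The source vertex -/

/-- **Source core.** At the source vertex `v` (`a = {u, v}`, `u ∉ Λ`), with `p, q` the two other
neighbours: from the loop-winding stub (W1), the local turns (W6), the source algebra (B) at a
loop-sum level `c`, and the loop bound `Z ≤ c` of `SourceLoopBound`, the six labelled no-fold
inequalities hold with the constant `k` of (B). [folklore] -/
theorem source_core
    (hW1 : ∀ (Λ : Finset HexVertex), hexDomainSimplyConnected Λ →
      ∀ (u v w₁ w₂ : HexVertex), u ∉ Λ → v ∈ Λ → hexGraph.Adj v u → hexGraph.Adj v w₁ →
        hexGraph.Adj v w₂ → u ≠ w₁ → u ≠ w₂ → w₁ ≠ w₂ →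
        ∀ δ : HexMidEdgeSAW (Λ.erase v) s(v, w₂) s(v, w₁),
          δ.winding = -5 * winding [hexMidpoint s(u, v), hexCenter v, hexMidpoint s(v, w₂)])
    (hW6 : ∀ (v p q r : HexVertex), hexGraph.Adj v p → hexGraph.Adj v q → hexGraph.Adj v r →
      p ≠ q → q ≠ r → p ≠ r →
      ∃ ε : ℝ, (ε = 1 ∨ ε = -1) ∧
        winding [hexMidpoint s(p, v), hexCenter v, hexMidpoint s(v, q)] = ε * (Real.pi / 3) ∧
        winding [hexMidpoint s(q, v), hexCenter v, hexMidpoint s(v, r)] = ε * (Real.pi / 3) ∧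
        winding [hexMidpoint s(r, v), hexCenter v, hexMidpoint s(v, p)] = ε * (Real.pi / 3) ∧
        winding [hexMidpoint s(q, v), hexCenter v, hexMidpoint s(v, p)] = -(ε * (Real.pi / 3)) ∧
        winding [hexMidpoint s(r, v), hexCenter v, hexMidpoint s(v, q)] = -(ε * (Real.pi / 3)) ∧
        winding [hexMidpoint s(p, v), hexCenter v, hexMidpoint s(v, r)] = -(ε * (Real.pi / 3)))
    {c k : ℝ}
    (HB : ∀ (ε : ℝ), (ε = 1 ∨ ε = -1) → ∀ (Z Z' : ℝ), 0 ≤ Z → Z ≤ c → 0 ≤ Z' → Z' ≤ c →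
      let x : ℝ := hexCriticalFugacity
      let e : ℝ → ℂ := fun t => Complex.exp (-Complex.I * (5 / 8 : ℝ) * t)
      let Fu : ℂ := 1
      let F₁ : ℂ := x * e (ε * (Real.pi / 3)) + x * e (4 * (ε * (Real.pi / 3))) * Z
      let F₂ : ℂ := x * e (-(ε * (Real.pi / 3))) + x * e (4 * (-(ε * (Real.pi / 3)))) * Z'
      let ω : ℂ := Complex.exp (2 * Real.pi * Complex.I / 3)
      let S : ℝ := ‖Fu + F₁ + F₂‖
      ‖Fu + ω * F₁ + ω ^ 2 * F₂‖ ≤ k * S ∧ ‖Fu + ω * F₂ + ω ^ 2 * F₁‖ ≤ k * S ∧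
      ‖F₁ + ω * Fu + ω ^ 2 * F₂‖ ≤ k * S ∧ ‖F₁ + ω * F₂ + ω ^ 2 * Fu‖ ≤ k * S ∧
      ‖F₂ + ω * Fu + ω ^ 2 * F₁‖ ≤ k * S ∧ ‖F₂ + ω * F₁ + ω ^ 2 * Fu‖ ≤ k * S)
    (hSLBc : ∀ (Λ : Finset HexVertex), hexDomainSimplyConnected Λ →
      ∀ u v w₁ w₂ : HexVertex, u ∉ Λ → v ∈ Λ → hexGraph.Adj v u → hexGraph.Adj v w₁ →
        hexGraph.Adj v w₂ → u ≠ w₁ → u ≠ w₂ → w₁ ≠ w₂ →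
        (∑ γ : HexMidEdgeSAW (Λ.erase v) s(v, w₁) s(v, w₂), hexCriticalFugacity ^ γ.length) ≤ c)
    {Λ : Finset HexVertex} (hΛ : hexDomainSimplyConnected Λ) {u v p q : HexVertex} (hu : u ∉ Λ)
    (hv : v ∈ Λ) (huv : hexGraph.Adj v u) (hp : hexGraph.Adj v p) (hq : hexGraph.Adj v q)
    (hup : u ≠ p) (huq : u ≠ q) (hpq : p ≠ q) (ha : s(u, v) ∈ hexDomainBoundary Λ) :
    let F : Sym2 HexVertex → ℂ := hexParafermionicObservable Λ s(u, v) hexCriticalFugacity (5 / 8)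
    let ω : ℂ := Complex.exp (2 * Real.pi * Complex.I / 3)
    let S : ℝ := ‖F s(v, u) + F s(v, p) + F s(v, q)‖
    ‖F s(v, u) + ω * F s(v, p) + ω ^ 2 * F s(v, q)‖ ≤ k * S ∧
    ‖F s(v, u) + ω * F s(v, q) + ω ^ 2 * F s(v, p)‖ ≤ k * S ∧
    ‖F s(v, p) + ω * F s(v, u) + ω ^ 2 * F s(v, q)‖ ≤ k * S ∧
    ‖F s(v, p) + ω * F s(v, q) + ω ^ 2 * F s(v, u)‖ ≤ k * S ∧
    ‖F s(v, q) + ω * F s(v, u) + ω ^ 2 * F s(v, p)‖ ≤ k * S ∧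
    ‖F s(v, q) + ω * F s(v, p) + ω ^ 2 * F s(v, u)‖ ≤ k * S := by
  dsimp only
  -- the chirality at `v` seen from `u`
  obtain ⟨ε, hε, Tup, -, -, -, -, Tuq⟩ := hW6 v u p q huv hp hq hup hpq huq
  -- the two loop sums
  set Z : ℝ := ∑ δ : HexMidEdgeSAW (Λ.erase v) s(v, q) s(v, p), hexCriticalFugacity ^ δ.length
    with hZ
  set Z' : ℝ := ∑ δ : HexMidEdgeSAW (Λ.erase v) s(v, p) s(v, q), hexCriticalFugacity ^ δ.length
    with hZ'
  have hZ0 : 0 ≤ Z := Finset.sum_nonneg fun δ _ => pow_nonneg nfb_xc_pos.le _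
  have hZ'0 : 0 ≤ Z' := Finset.sum_nonneg fun δ _ => pow_nonneg nfb_xc_pos.le _
  have hZc : Z ≤ c := hSLBc Λ hΛ u v q p hu hv huv hq hp huq hup hpq.symm
  have hZ'c : Z' ≤ c := hSLBc Λ hΛ u v p q hu hv huv hp hq hup huq hpq
  -- the loop observables
  have hLq : hexParafermionicObservable (Λ.erase v) s(v, q) hexCriticalFugacity (5 / 8) s(v, p) =
      Complex.exp (-Complex.I * (5 / 8 : ℝ) * ((-5 * -(ε * (Real.pi / 3)) : ℝ) : ℂ)) * (Z : ℂ) := by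
    rw [hexParafermionicObservable_def, hZ]
    refine sum_weight_eq_of_winding_eq _ _ _ fun δ => ?_
    rw [hW1 Λ hΛ u v p q hu hv huv hp hq hup huq hpq δ, Tuq]
  have hLp : hexParafermionicObservable (Λ.erase v) s(v, p) hexCriticalFugacity (5 / 8) s(v, q) =
      Complex.exp (-Complex.I * (5 / 8 : ℝ) * ((-5 * (ε * (Real.pi / 3)) : ℝ) : ℂ)) * (Z' : ℂ) := by
    rw [hexParafermionicObservable_def, hZ']
    refine sum_weight_eq_of_winding_eq _ _ _ fun δ => ?_
    rw [hW1 Λ hΛ u v q p hu hv huv hq hp huq hup hpq.symm δ, Tup]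
  -- the three values at `v`
  have eFu : hexParafermionicObservable Λ s(u, v) hexCriticalFugacity (5 / 8) s(v, u) = 1 := by
    rw [Sym2.eq_swap (a := v)]
    exact hexParafermionicObservable_self ha _ _
  have eFp : hexParafermionicObservable Λ s(u, v) hexCriticalFugacity (5 / 8) s(v, p) =
      hexCriticalFugacity * Complex.exp (-Complex.I * (5 / 8 : ℝ) * ((ε * (Real.pi / 3) : ℝ) : ℂ)) +
      hexCriticalFugacity * Complex.exp (-Complex.I * (5 / 8 : ℝ) *
        ((4 * (ε * (Real.pi / 3)) : ℝ) : ℂ)) * (Z : ℂ) := by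
    rw [SourceLoopBound.sourcePort hu hv huv hp hq hup huq hpq, Tup, Tuq, hLq, xexp_mul_exp_mul,
      show (-(ε * (Real.pi / 3)) + -5 * -(ε * (Real.pi / 3)) : ℝ) = 4 * (ε * (Real.pi / 3)) by ring]
  have eFq : hexParafermionicObservable Λ s(u, v) hexCriticalFugacity (5 / 8) s(v, q) =
      hexCriticalFugacity * Complex.exp (-Complex.I * (5 / 8 : ℝ) *
        ((-(ε * (Real.pi / 3)) : ℝ) : ℂ)) +
      hexCriticalFugacity * Complex.exp (-Complex.I * (5 / 8 : ℝ) *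
        ((4 * (-(ε * (Real.pi / 3))) : ℝ) : ℂ)) * (Z' : ℂ) := by
    rw [SourceLoopBound.sourcePort hu hv huv hq hp huq hup hpq.symm, Tup, Tuq, hLp, xexp_mul_exp_mul,
      show (ε * (Real.pi / 3) + -5 * (ε * (Real.pi / 3)) : ℝ) = 4 * (-(ε * (Real.pi / 3))) by ring]
  have h6 := HB ε hε Z Z' hZ0 hZc hZ'0 hZ'c
  dsimp only at h6
  rw [eFu, eFp, eFq]
  exact h6

end Summit.CriticalPhenomena.SAWScalingLimit.Theorems.SAWDevelopingMapNoFoldBound
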